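import Literature.IUT.HodgeTheaters.GlobalFrobenioidsArithmeticPullback
import Literature.IUT.HodgeTheaters.GlobalFrobenioidsInfKappa
import HarnessLib

/-!
# [IUTchI] Example 5.1 (v): NON-VACUITY of the interface `PrimeLabelling` ("`Prime(†ℱ^⊛_mod) ⥲ 𝕍_mod`") at the
# arithmetic model (PROOF-ONLY; NV-L5 row `PrimeLabelling`)

Mochizuki, *Inter-universal Teichmüller theory I*, §5, Example 5.1 (v), kurims manuscript (May 2020) p. 129
([IUTchI] Ex 5.1 (v) p.129) [claim: Mochizuki2012, status: disputed]: "a purely category-theoretic construction,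
from the category `†ℱ^⊛`, of the natural bijection `Prime(†ℱ^⊛_mod) ⥲ 𝕍_mod`".

abc-iut-L5-t12 typed this as the INTERFACE `PrimeLabelling Δ Vmod` (`GlobalFrobenioidsInfKappa.lean`: a terminal
object `A₀` of `†𝒟^⊛` and a bijection `Prime(Φ^⊛(A₀)) ≃ Vmod`), which the L5 inhabitation census (abc-iut-w5-d197,
INHABITATION-CENSUS-L5 v1) lists with ZERO producers.  PROOF-ONLY witness (abc-iut-w4-d050, L5-lead RULINGS #27 NV-L5
row family): at the ARITHMETIC MODEL `GlobalDivisorData.arith F` ([FrdI] Ex 6.3 over `ℬ(G_F)⁰`,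
`GlobalFrobenioidsArithmeticModel.lean`) the interface IS inhabited with `Vmod :=` the places of the number field of
the terminal object — which is the bottom subextension `F ⊆ F̄`, i.e. `F_mod` itself (`arith_field_terminal`) — the
bijection being abc-iut-L1's [FrdI] Ex 6.3 "`Prime(Φ(L)) ≃ V(L)`" (`Ex63_primes_holds`).  Honest suffix `_model`:
a witness at one model, not a construction for arbitrary `†ℱ^⊛`.  No definitions; no new Prop fact; no statement of
the paper is strengthened; no side is taken on [IUTchIII] Cor. 3.12.
-/

noncomputable section

namespace Literature.IUT.HodgeTheaters

open CategoryTheory Opposite Literature.AlgebraicGeometry.Frobenioids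
open Literature.AlgebraicGeometry.Frobenioids.QuasiTemperoid

variable (F : Type) [Field F] [NumberField F]

/-- **NV-L5 `PrimeLabelling` — [IUTchI] Ex 5.1 (v) "`Prime(†ℱ^⊛_mod) ⥲ 𝕍_mod`" is INHABITED at the arithmetic model**:
for the divisor data `GlobalDivisorData.arith F` there is an object `X₀ = Spec F_mod` of abc-iut-L1's base (its field IS the
bottom subextension `F ⊆ F̄`, i.e. `F_mod`) and a `PrimeLabelling` with `Vmod := V(F_mod) = Places X₀.L`: `A₀ :=` a terminal
object of `ℬ(G_F)⁰` (`exists_isTerminal_baseCat`) — whose number field is `F_mod` (`arith_field_terminal`) and whose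
`Prime(Φ^⊛(A₀))` is LITERALLY `Prime(Φ(F_mod))` — and `equiv :=` the inverse of abc-iut-L1's [FrdI] Ex 6.3 bijection
`V(L) → Prime(Φ(L))`, `v ↦ [v]` (`Ex63_primes_holds`).  Witness at ONE model (`_model`); terminal objects are one-point
(`subsingleton_of_isTerminal`). ([IUTchI] Ex 5.1 (v) p.129) [claim: Mochizuki2012, status: disputed] -/
theorem exists_primeLabelling_arith_model :
    ∃ X₀ : FinSubextCat F (Fbar F), X₀.L = ⊥ ∧
      ∃ P : PrimeLabelling (GlobalDivisorData.arith F) (Places X₀.L), Subsingleton P.A₀.obj.obj.V := by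
  obtain ⟨A₀, ⟨hA₀⟩⟩ := exists_isTerminal_baseCat (absGalGrp F)
  obtain ⟨hprim, hbij⟩ := Ex63_primes_holds ((galoisSubextOfFinite F).obj A₀).L
  exact ⟨(galoisSubextOfFinite F).obj A₀, arith_field_terminal F hA₀,
    { A₀ := A₀
      isTerminal := hA₀
      equiv := (Equiv.ofBijective _ hbij).symm }, subsingleton_of_isTerminal hA₀⟩

/-- `Nonempty` form of the witness (the shape the inhabitation census reads): some `PrimeLabelling` of the arithmetic
model's divisor data exists, with `Vmod` the places of [the field of] an object `Spec F_mod` of abc-iut-L1's base.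
([IUTchI] Ex 5.1 (v) p.129) [claim: Mochizuki2012, status: disputed] -/
theorem nonempty_primeLabelling_arith_model :
    ∃ X₀ : FinSubextCat F (Fbar F), Nonempty (PrimeLabelling (GlobalDivisorData.arith F) (Places X₀.L)) := by
  obtain ⟨X₀, -, P, -⟩ := exists_primeLabelling_arith_model F
  exact ⟨X₀, ⟨P⟩⟩

end Literature.IUT.HodgeTheaters

end
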